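import Summits.ABC.ABC.Theses.TwistAmplification
import Literature.NumberTheory.DiophantineGeometry.AbcShapeReductionCount

/-!
# Route TwistAmplification — crux `MazurKaneLaw` (stmt-ABC-2757), line `peyre-level-torsor-v22`: stub `SliceReduction`

The SLICE VERSION of the tree's reduction `AbcShapes.abcExponentCount_le_of_shapeCount_le`
([BernertEtAl2024, Prop. 2.1], `Literature/NumberTheory/DiophantineGeometry/AbcShapeReductionCount.lean`):
if `B_M(c; X, Y, Z) ≤ K · C₀^θ` for all class data admissible for exponent `s + ε` at scale `C₀`
(`AbcShapes.Admissible (s + ε) ε`) which moreover satisfy the slice lower bound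
`C₀^{s-η} ≤ (2C₀)^{3ε/2} · 8^M · ∏ᵢ XᵢYᵢZᵢ`, then for every `N` the slice count
`#{abc : c ≤ N, c^{s-η} < rad(abc) ≤ c^s} ≤ K · #classRange ε N · N^θ`.

Proof: the tree proof verbatim (fibre the slice set over `tripleClass ε` into `classRange ε N`;
a non-empty fibre has a witness `t₀` whose class data are admissible for exponent `s + ε` —
`rad ≤ c^s < c^{s+ε}` as `c ≥ 2` — by `admissible_of_triple`, and injects into `shapeTriples` by
`tripleShapes_mem_shapeTriples` / `eq_of_tripleClass_eq`; `(2^k)^θ ≤ N^θ`), plus one new step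
(`sliceLower_of_triple`): the witness transports the slice lower bound to the class data, via
`C₀^{s-η} ≤ c₀^{s-η} < rad(a₀b₀c₀) = rad a₀ · rad b₀ · rad c₀` and, for each term `n`,
`rad n ≤ cof · ∏ⱼ xⱼ ≤ (2C₀)^{ε/2} · 2^M ∏ⱼ Xⱼ` (`radical n ∣ cof · shapeProd x` because every prime of
`n = cof · shapeVal x` divides `cof · shapeProd x` and the radical is squarefree; `xⱼ < 2Xⱼ`).
No new definitions; standard material on top of the tree [folklore].
-/

namespace Summit.ABC.ABC.Theorems

open Finset UniqueFactorizationMonoid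
open Literature.NumberTheory.DiophantineGeometry
open Literature.NumberTheory.DiophantineGeometry.AbcShapes

noncomputable section

/-- `rad n ≤ cof · ∏ⱼ xⱼ` for the chosen shape factorisation `n = cof · ∏ⱼ xⱼ^{j}` of `n ≥ 1`:
every prime of `n` divides `cof · ∏ⱼ xⱼ` (`prime_dvd_mul_shapeProd`) and `rad n` is the product of
the primes of `n` (`Nat.radical_dvd_iff`). [folklore] -/
private theorem SliceReduction.radical_le_cof_mul_shapeProd {ε : ℝ} (hε : 0 < ε) (hε2 : ε < 1 / 2)
    {n : ℕ} (hn : 0 < n) :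
    ((radical n : ℕ) : ℝ) ≤
      ((fac ε n).1 : ℝ) * (shapeProd (toFin (numShapes ε) (fac ε n).2) : ℝ) := by
  obtain ⟨hc, hx, hf, -, -⟩ := fac_toFin_spec hε hε2 hn
  have hm : 0 < (fac ε n).1 * shapeProd (toFin (numShapes ε) (fac ε n).2) :=
    Nat.mul_pos hc (prod_pos fun i _ => hx i)
  have hdvd : radical n ∣ (fac ε n).1 * shapeProd (toFin (numShapes ε) (fac ε n).2) := by
    rw [Nat.radical_dvd_iff hm.ne']
    intro p hp
    obtain ⟨hp, hpn, -⟩ := Nat.mem_primeFactors.mp hp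
    refine Nat.mem_primeFactors.mpr ⟨hp, prime_dvd_mul_shapeProd hp ?_, hm.ne'⟩
    rw [hf]
    exact hpn
  exact_mod_cast Nat.le_of_dvd hm hdvd

/-- `∏ⱼ xⱼ ≤ 2^M · ∏ⱼ 2^{⌊log₂ xⱼ⌋}` for a positive tuple (`xⱼ < 2 · 2^{⌊log₂ xⱼ⌋}`). [folklore] -/
private theorem SliceReduction.shapeProd_le_two_pow_mul_prod_classBox {M : ℕ} {x : Fin M → ℕ}
    (hx : ∀ i, 0 < x i) :
    (shapeProd x : ℝ) ≤ (2 : ℝ) ^ M * ∏ i, ((classBox (fun i => Nat.log 2 (x i)) i : ℕ) : ℝ) := by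
  have h1 : shapeProd x ≤ ∏ i, 2 * classBox (fun i => Nat.log 2 (x i)) i :=
    prod_le_prod (fun i _ => Nat.zero_le _) fun i _ => (mem_Ico.mp (mem_Ico_pow_log (hx i))).2.le
  have h2 : (∏ i, 2 * classBox (fun i => Nat.log 2 (x i)) i) =
      2 ^ M * ∏ i, classBox (fun i => Nat.log 2 (x i)) i := by
    rw [prod_mul_distrib, prod_const, card_univ, Fintype.card_fin]
  exact_mod_cast h1.trans_eq h2

/-- `c ≥ 2 > 1` for an abc triple (`a, b ≥ 1`, `a + b = c`). [folklore] -/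
private theorem SliceReduction.one_lt_of_isABCTriple {t : ℕ × ℕ × ℕ}
    (ht : IsABCTriple t.1 t.2.1 t.2.2) : (1 : ℝ) < (t.2.2 : ℝ) := by
  obtain ⟨ha, hb, habc, -⟩ := ht
  have h2 : 2 ≤ t.2.2 := by omega
  exact_mod_cast h2

/-- The slice set `{abc : c ≤ N, c^{σ} < rad(abc) ≤ c^s}` lies in `[0, N]³`, so it is finite.
[folklore] -/
private theorem SliceReduction.finite_slice (N : ℕ) (σ s : ℝ) :
    {t : ℕ × ℕ × ℕ | IsABCTriple t.1 t.2.1 t.2.2 ∧ t.2.2 ≤ N ∧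
      (t.2.2 : ℝ) ^ σ < ((rad t.1 t.2.1 t.2.2 : ℕ) : ℝ) ∧
      ((rad t.1 t.2.1 t.2.2 : ℕ) : ℝ) ≤ (t.2.2 : ℝ) ^ s}.Finite := by
  refine ((Set.finite_Iic N).prod ((Set.finite_Iic N).prod (Set.finite_Iic N))).subset ?_
  rintro ⟨a, b, c⟩ ⟨⟨ha, hb, habc, -⟩, hcN, -⟩
  simp only [Set.mem_prod, Set.mem_Iic] at *
  omega

/-- **The slice lower bound, transported to class data.** If `c^{σ} < rad(abc)` (`σ ≥ 0`) for an
abc triple of class `(k, (c₁, c₂, c₃), (e_X, e_Y, e_Z))`, then with `C₀ = 2^k`, `Xᵢ = 2^{e_X i}`, …: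
`C₀^{σ} ≤ (2C₀)^{3ε/2} · 8^M · ∏ᵢ XᵢYᵢZᵢ`. Indeed `C₀ ≤ c`, `rad(abc) = rad a · rad b · rad c`, and for
each term `rad n ≤ cof · ∏ⱼ xⱼ ≤ (2C₀)^{ε/2} · 2^M ∏ⱼ Xⱼ`. [folklore] -/
private theorem SliceReduction.sliceLower_of_triple {ε : ℝ} (hε : 0 < ε) (hε2 : ε < 1 / 2)
    {σ : ℝ} (hσ : 0 ≤ σ) {t : ℕ × ℕ × ℕ} (ht : IsABCTriple t.1 t.2.1 t.2.2)
    (hlow : (t.2.2 : ℝ) ^ σ < ((rad t.1 t.2.1 t.2.2 : ℕ) : ℝ))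
    {k c₁ c₂ c₃ : ℕ} {eX eY eZ : Fin (numShapes ε) → ℕ}
    (hq : tripleClass ε t = (k, (c₁, c₂, c₃), (eX, eY, eZ))) :
    ((2 ^ k : ℕ) : ℝ) ^ σ ≤ (2 * ((2 ^ k : ℕ) : ℝ)) ^ (3 * ε / 2) * (8 : ℝ) ^ (numShapes ε) *
      ∏ i, (((classBox eX i : ℕ) : ℝ) * ((classBox eY i : ℕ) : ℝ) * ((classBox eZ i : ℕ) : ℝ)) := by
  obtain ⟨a, b, c⟩ := t
  have ht' := ht
  obtain ⟨ha, hb, habc, -⟩ := ht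
  simp only at ha hb habc hlow ht'
  have hc : 0 < c := by omega
  simp only [tripleClass, Prod.mk.injEq] at hq
  obtain ⟨rfl, ⟨rfl, rfl, rfl⟩, rfl, rfl, rfl⟩ := hq
  obtain ⟨-, hxa, -, hcale, -⟩ := fac_toFin_spec hε hε2 ha
  obtain ⟨-, hxb, -, hcble, -⟩ := fac_toFin_spec hε hε2 hb
  obtain ⟨-, hxc, -, hccle, -⟩ := fac_toFin_spec hε hε2 hc
  have hra := SliceReduction.radical_le_cof_mul_shapeProd hε hε2 ha
  have hrb := SliceReduction.radical_le_cof_mul_shapeProd hε hε2 hb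
  have hrc := SliceReduction.radical_le_cof_mul_shapeProd hε hε2 hc
  simp only [tripleShapes] at *
  -- notation
  set M := numShapes ε with hM
  set xa := toFin M (fac ε a).2 with hxa'
  set xb := toFin M (fac ε b).2 with hxb'
  set xc := toFin M (fac ε c).2 with hxc'
  set C₀ : ℕ := 2 ^ Nat.log 2 c with hC₀
  -- the dyadic scale: `C₀ ≤ c < 2 C₀`
  have hC₀c : C₀ ≤ c ∧ c < 2 * C₀ := mem_Ico.mp (mem_Ico_pow_log hc)
  have h2C₀ : (0 : ℝ) < 2 * C₀ := by positivity
  have hc2 : (c : ℝ) ≤ 2 * C₀ := by exact_mod_cast hC₀c.2.le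
  have ha2 : (a : ℝ) ≤ 2 * C₀ := le_trans (by exact_mod_cast (by omega : a ≤ c)) hc2
  have hb2 : (b : ℝ) ≤ 2 * C₀ := le_trans (by exact_mod_cast (by omega : b ≤ c)) hc2
  -- the three products of box parameters
  set PX : ℝ := ∏ i, ((classBox (fun i => Nat.log 2 (xa i)) i : ℕ) : ℝ) with hPX
  set PY : ℝ := ∏ i, ((classBox (fun i => Nat.log 2 (xb i)) i : ℕ) : ℝ) with hPY
  set PZ : ℝ := ∏ i, ((classBox (fun i => Nat.log 2 (xc i)) i : ℕ) : ℝ) with hPZ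
  -- cofactors: `cof ≤ n^{ε/2} ≤ (2C₀)^{ε/2}`
  have hcoa : ((fac ε a).1 : ℝ) ≤ (2 * C₀ : ℝ) ^ (ε / 2) :=
    hcale.trans (Real.rpow_le_rpow (by positivity) ha2 (by positivity))
  have hcob : ((fac ε b).1 : ℝ) ≤ (2 * C₀ : ℝ) ^ (ε / 2) :=
    hcble.trans (Real.rpow_le_rpow (by positivity) hb2 (by positivity))
  have hcoc : ((fac ε c).1 : ℝ) ≤ (2 * C₀ : ℝ) ^ (ε / 2) :=
    hccle.trans (Real.rpow_le_rpow (by positivity) hc2 (by positivity))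
  -- each radical: `rad n ≤ cof · ∏ xⱼ ≤ (2C₀)^{ε/2} · (2^M ∏ Xⱼ)`
  have hRa : ((radical a : ℕ) : ℝ) ≤ (2 * C₀ : ℝ) ^ (ε / 2) * ((2 : ℝ) ^ M * PX) :=
    hra.trans (mul_le_mul hcoa (SliceReduction.shapeProd_le_two_pow_mul_prod_classBox hxa)
      (by positivity) (by positivity))
  have hRb : ((radical b : ℕ) : ℝ) ≤ (2 * C₀ : ℝ) ^ (ε / 2) * ((2 : ℝ) ^ M * PY) :=
    hrb.trans (mul_le_mul hcob (SliceReduction.shapeProd_le_two_pow_mul_prod_classBox hxb)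
      (by positivity) (by positivity))
  have hRc : ((radical c : ℕ) : ℝ) ≤ (2 * C₀ : ℝ) ^ (ε / 2) * ((2 : ℝ) ^ M * PZ) :=
    hrc.trans (mul_le_mul hcoc (SliceReduction.shapeProd_le_two_pow_mul_prod_classBox hxc)
      (by positivity) (by positivity))
  -- `C₀^σ ≤ c^σ < rad(abc) = rad a · rad b · rad c`
  have hlow' : ((C₀ : ℕ) : ℝ) ^ σ <
      ((radical a : ℕ) : ℝ) * ((radical b : ℕ) : ℝ) * ((radical c : ℕ) : ℝ) := by
    have h2 : ((rad a b c : ℕ) : ℝ) =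
        ((radical a : ℕ) : ℝ) * ((radical b : ℕ) : ℝ) * ((radical c : ℕ) : ℝ) := by
      rw [rad_eq_mul_of_isABCTriple ht']; push_cast; ring
    rw [← h2]
    exact (Real.rpow_le_rpow (by positivity) (by exact_mod_cast hC₀c.1) hσ).trans_lt hlow
  -- exponent algebra
  have h4 : ((2 * C₀ : ℝ) ^ (ε / 2)) ^ 3 = (2 * C₀ : ℝ) ^ (3 * ε / 2) := by
    rw [← Real.rpow_natCast, ← Real.rpow_mul h2C₀.le]
    congr 1; push_cast; ring
  have h8 : ((2 : ℝ) ^ M) ^ 3 = (8 : ℝ) ^ M := by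
    rw [← pow_mul, mul_comm, pow_mul]; norm_num
  have hprod : PX * PY * PZ = ∏ i, (((classBox (fun i => Nat.log 2 (xa i)) i : ℕ) : ℝ) *
      ((classBox (fun i => Nat.log 2 (xb i)) i : ℕ) : ℝ) *
      ((classBox (fun i => Nat.log 2 (xc i)) i : ℕ) : ℝ)) := by
    rw [prod_mul_distrib, prod_mul_distrib]
  -- assemble
  calc ((C₀ : ℕ) : ℝ) ^ σ
      ≤ ((radical a : ℕ) : ℝ) * ((radical b : ℕ) : ℝ) * ((radical c : ℕ) : ℝ) := hlow'.le
    _ ≤ ((2 * C₀ : ℝ) ^ (ε / 2) * ((2 : ℝ) ^ M * PX)) * ((2 * C₀ : ℝ) ^ (ε / 2) * ((2 : ℝ) ^ M * PY)) *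
          ((2 * C₀ : ℝ) ^ (ε / 2) * ((2 : ℝ) ^ M * PZ)) :=
        mul_le_mul (mul_le_mul hRa hRb (by positivity) (by positivity)) hRc (by positivity)
          (by positivity)
    _ = ((2 * C₀ : ℝ) ^ (ε / 2)) ^ 3 * ((2 : ℝ) ^ M) ^ 3 * (PX * PY * PZ) := by ring
    _ = (2 * C₀ : ℝ) ^ (3 * ε / 2) * (8 : ℝ) ^ M * ∏ i, (((classBox (fun i => Nat.log 2 (xa i)) i : ℕ) : ℝ) *
          ((classBox (fun i => Nat.log 2 (xb i)) i : ℕ) : ℝ) *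
          ((classBox (fun i => Nat.log 2 (xc i)) i : ℕ) : ℝ)) := by
        rw [h4, h8, hprod]

/-- **Stub C2 · `SliceReduction`** of line `peyre-level-torsor-v22` (crux `MazurKaneLaw`, stmt-ABC-2757):
the slice version of [BernertEtAl2024, Prop. 2.1] (tree: `abcExponentCount_le_of_shapeCount_le`).
If `B_M(c; X, Y, Z) ≤ K · C₀^θ` for all data admissible for `(s + ε, ε)` at scale `C₀` that satisfy
the slice lower bound `C₀^{s-η} ≤ (2C₀)^{3ε/2} · 8^M · ∏ᵢ XᵢYᵢZᵢ`, then for every `N`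
`#{abc : c ≤ N, c^{s-η} < rad(abc) ≤ c^s} ≤ K · #classRange ε N · N^θ`. Proof: fibre the slice set
over `tripleClass ε`; a non-empty fibre injects into the `B_M` of its class
(`tripleShapes_mem_shapeTriples`, `eq_of_tripleClass_eq`), whose data are admissible for exponent
`s + ε` (`admissible_of_triple`, as `rad ≤ c^s < c^{s+ε}`) and satisfy the slice lower bound
(`sliceLower_of_triple`); then `(2^k)^θ ≤ N^θ` and sum over `classRange ε N`. [folklore] -/
theorem SliceReduction : ∀ s : ℝ, 1 < s → s < 2 → ∀ ε : ℝ, 0 < ε → ε ≤ 1 / 4 → ∀ η : ℝ, 0 < η → η ≤ s → ∀ θ K : ℝ, 0 ≤ θ → 0 ≤ K → (∀ (C₀ c₁ c₂ c₃ : ℕ) (X Y Z : Fin (Literature.NumberTheory.DiophantineGeometry.AbcShapes.numShapes ε) → ℕ), Literature.NumberTheory.DiophantineGeometry.AbcShapes.Admissible (s + ε) ε C₀ c₁ c₂ c₃ X Y Z → ((C₀ : ℝ) ^ (s - η) ≤ (2 * (C₀ : ℝ)) ^ (3 * ε / 2) * (8 : ℝ) ^ (Literature.NumberTheory.DiophantineGeometry.AbcShapes.numShapes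 ε) * ∏ i, ((X i : ℝ) * Y i * Z i)) → (Literature.NumberTheory.DiophantineGeometry.AbcShapes.shapeCount c₁ c₂ c₃ X Y Z : ℝ) ≤ K * (C₀ : ℝ) ^ θ) → ∀ N : ℕ, (Set.ncard {t : ℕ × ℕ × ℕ | Literature.NumberTheory.DiophantineGeometry.IsABCTriple t.1 t.2.1 t.2.2 ∧ t.2.2 ≤ N ∧ (t.2.2 : ℝ) ^ (s - η) < ((Literature.NumberTheory.DiophantineGeometry.rad t.1 t.2.1 t.2.2 : ℕ) : ℝ) ∧ ((Literature.NumberTheory.DiophantineGeometry.rad t.1 t.2.1 t.2.2 : ℕ) : ℝ) ≤ (t.2.2 : ℝ) ^ s} : ℝ) ≤ K * (Literature.NumberTheory.DiophantineGeometry.AbcShapes.classRange ε N).card * (N : ℝ) ^ θ := by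
  intro s hs1 _hs2 ε hε hε4 η hη hηs θ K hθ hK hB N
  classical
  have hε2 : ε < 1 / 2 := by linarith
  have hl : 0 ≤ s + ε := by linarith
  have hσ : 0 ≤ s - η := by linarith
  have hfin := SliceReduction.finite_slice N (s - η) s
  set H := hfin.toFinset with hH
  have hmem : ∀ t ∈ H, IsABCTriple t.1 t.2.1 t.2.2 ∧ t.2.2 ≤ N ∧
      (t.2.2 : ℝ) ^ (s - η) < ((rad t.1 t.2.1 t.2.2 : ℕ) : ℝ) ∧
      ((rad t.1 t.2.1 t.2.2 : ℕ) : ℝ) ≤ (t.2.2 : ℝ) ^ s := by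
    intro t ht
    simpa [hH, Set.Finite.mem_toFinset] using ht
  have hmaps : Set.MapsTo (tripleClass ε) (H : Set _) (classRange ε N : Set _) := fun t ht =>
    mem_coe.mpr (tripleClass_mem_classRange hε hε2 (hmem t (mem_coe.mp ht)).1
      (hmem t (mem_coe.mp ht)).2.1)
  have hNθ : 0 ≤ K * (N : ℝ) ^ θ := by positivity
  have hfib : ∀ q ∈ classRange ε N,
      ((H.filter (fun t => tripleClass ε t = q)).card : ℝ) ≤ K * (N : ℝ) ^ θ := by
    rintro ⟨k, ⟨c₁, c₂, c₃⟩, ⟨eX, eY, eZ⟩⟩ -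
    rcases (H.filter (fun t => tripleClass ε t = (k, (c₁, c₂, c₃), (eX, eY, eZ)))).eq_empty_or_nonempty
      with he | ⟨t₀, ht₀⟩
    · rw [he, card_empty, Nat.cast_zero]; exact hNθ
    obtain ⟨ht₀H, hq₀⟩ := mem_filter.mp ht₀
    obtain ⟨htr₀, hcN₀, hlow₀, hup₀⟩ := hmem t₀ ht₀H
    -- `rad ≤ c^s < c^{s+ε}` since `c ≥ 2`
    have hrad₀ : ((rad t₀.1 t₀.2.1 t₀.2.2 : ℕ) : ℝ) < (t₀.2.2 : ℝ) ^ (s + ε) :=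
      hup₀.trans_lt (Real.rpow_lt_rpow_of_exponent_lt
        (SliceReduction.one_lt_of_isABCTriple htr₀) (by linarith))
    obtain ⟨hadm, hC₀c⟩ := admissible_of_triple hε hε2 hl htr₀ hrad₀ hq₀
    have hsl := SliceReduction.sliceLower_of_triple hε hε2 hσ htr₀ hlow₀ hq₀
    have h1 : (H.filter (fun t => tripleClass ε t = (k, (c₁, c₂, c₃), (eX, eY, eZ)))).card ≤
        shapeCount c₁ c₂ c₃ (classBox eX) (classBox eY) (classBox eZ) := by
      rw [shapeCount]
      refine card_le_card_of_injOn (tripleShapes ε) (fun t ht => ?_) (fun t ht t' ht' h => ?_)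
      · obtain ⟨htH, hq⟩ := mem_filter.mp (mem_coe.mp ht)
        exact mem_coe.mpr (tripleShapes_mem_shapeTriples hε hε2 (hmem t htH).1 hq)
      · obtain ⟨htH, hq⟩ := mem_filter.mp (mem_coe.mp ht)
        obtain ⟨htH', hq'⟩ := mem_filter.mp (mem_coe.mp ht')
        exact eq_of_tripleClass_eq hε hε2 (hmem t htH).1 (hmem t' htH').1 (hq.trans hq'.symm) h
    have h2 := hB _ _ _ _ _ _ _ hadm hsl
    have h3 : (((2 ^ k : ℕ) : ℝ)) ^ θ ≤ (N : ℝ) ^ θ :=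
      Real.rpow_le_rpow (by positivity) (by exact_mod_cast hC₀c.trans hcN₀) hθ
    calc (((H.filter (fun t => tripleClass ε t = (k, (c₁, c₂, c₃), (eX, eY, eZ)))).card : ℕ) : ℝ)
        ≤ (shapeCount c₁ c₂ c₃ (classBox eX) (classBox eY) (classBox eZ) : ℝ) := by
          exact_mod_cast h1
      _ ≤ K * ((2 ^ k : ℕ) : ℝ) ^ θ := h2
      _ ≤ K * (N : ℝ) ^ θ := mul_le_mul_of_nonneg_left h3 hK
  calc (Set.ncard {t : ℕ × ℕ × ℕ | IsABCTriple t.1 t.2.1 t.2.2 ∧ t.2.2 ≤ N ∧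
          (t.2.2 : ℝ) ^ (s - η) < ((rad t.1 t.2.1 t.2.2 : ℕ) : ℝ) ∧
          ((rad t.1 t.2.1 t.2.2 : ℕ) : ℝ) ≤ (t.2.2 : ℝ) ^ s} : ℝ) = (H.card : ℝ) := by
        rw [Set.ncard_eq_toFinset_card _ hfin]
    _ = ∑ q ∈ classRange ε N, ((H.filter (fun t => tripleClass ε t = q)).card : ℝ) := by
        rw [card_eq_sum_card_fiberwise hmaps]; push_cast; rfl
    _ ≤ ∑ q ∈ classRange ε N, K * (N : ℝ) ^ θ := sum_le_sum hfib
    _ = K * (classRange ε N).card * (N : ℝ) ^ θ := by rw [sum_const, nsmul_eq_mul]; ring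

end

end Summit.ABC.ABC.Theorems
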